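import Summits.CriticalPhenomena.SAWScalingLimit.Theorems.CriticalBubbleBound.Negative.CriticalBubbleBoundOneNumber

/-!
# Sketch (crux-ideate, stmt-CriticalPhenomena-17588 `BulkShellTight`, ideator 1, round 1)

First lemmas of the idea card `door-pinch-bubble`: the PINCHED-DOOR sector of the registered bulk atom
X2c₁ᵇ `VirginArcTraversalTightBounded` (lead line `Sketch` v9 of the parent crux) — doors `c ∼ c'`
lattice-adjacent — has a FREE denominator (the one-edge arc) and a numerator that is monotone in the
exterior (arcs of `H ≤ ℤ²` inside `Λ` are lattice SAWs), so it reduces BY NAME to the finiteness of the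
critical bubble `G_{x_c}(0,e₀)` = item stmt-CriticalPhenomena-7117 `SAWTotalPositivity.CriticalBubbleBound`
(⟺ `Σ_N N q_N x_c^N < ∞`, `criticalBubbleBound_iff_polygonSeries_ne_top`), already with threshold `k = 1`.
Statements only (`sorry`); they elaborate over tree vocabulary.
-/

noncomputable section

open MeasureTheory Filter Topology Set Metric
open scoped ENNReal NNReal
open Literature.Probability.RandomPlanarGeometry Literature.Probability.LatticeModels
open Literature.Probability.RandomPlanarGeometry.SAW (criticalFugacity)
open Summit.CriticalPhenomena.SAWScalingLimit.Theorems.CriticalBubbleBound.Negative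
  (LatticeSAW latticeKernel bubble e₀)
open Summit.CriticalPhenomena.SAWScalingLimit.Theses.SAWTotalPositivity (CriticalBubbleBound)

namespace Summit.CriticalPhenomena.SAWScalingLimit.Cruxes.BulkShellTight.DoorPinchBubble

/-! ### Verbatim copies of the virgin-arc vocabulary of `Cruxes/EventualTight/Lines/Sketch.lean` v9
(`HasVertexTraversals`, `IsVirgin`, `IsDoor`, `Arc`, `arcMass`, `travMass`), so that this work file does not
depend on the lead's skeleton module (whose olean is re-registered every cycle). -/

/-- `k` weak vertex traversals of `D(x; r, R)` by a list of points (AB99 §3.a). [verbatim copy] -/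
def HasVertexTraversals (l : List ℂ) (k : ℕ) (x : ℂ) (r R : ℝ) : Prop :=
  ∃ ι κ : Fin k → Fin l.length, (∀ m, ι m ≤ κ m) ∧
    (∀ m, (dist (l.get (ι m)) x ≤ r ∧ R ≤ dist (l.get (κ m)) x) ∨
      (R ≤ dist (l.get (ι m)) x ∧ dist (l.get (κ m)) x ≤ r)) ∧
    ∀ ⦃m m'⦄, m < m' → κ m ≤ ι m'

/-- Virgin configuration at `(z₀, N)`. [verbatim copy] -/
def IsVirgin (H : SimpleGraph (Site 2)) (Λ : Set (Site 2)) (z₀ : ℂ) (N : ℝ) : Prop :=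
  H ≤ zdGraph 2 ∧ (∀ v : Site 2, dist (Site.toComplex v) z₀ ≤ N → v ∈ Λ) ∧
    ∀ v v' : Site 2, dist (Site.toComplex v) z₀ ≤ N + 1 → dist (Site.toComplex v') z₀ ≤ N + 1 →
      (zdGraph 2).Adj v v' → H.Adj v v'

/-- Door on the circle of radius `N`. [verbatim copy] -/
def IsDoor (H : SimpleGraph (Site 2)) (Λ : Set (Site 2)) (z₀ : ℂ) (N : ℝ) (u c : Site 2) : Prop :=
  H.Adj u c ∧ u ∉ Λ ∧ c ∈ Λ ∧ dist (Site.toComplex c) z₀ ≤ N ∧ N < dist (Site.toComplex u) z₀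

/-- Arcs: self-avoiding `H`-walks `c → c'` inside `Λ`. [verbatim copy] -/
def Arc (H : SimpleGraph (Site 2)) (Λ : Set (Site 2)) (c c' : Site 2) : Type :=
  {p : H.Walk c c' // p.IsPath ∧ ∀ v ∈ p.support, v ∈ Λ}

/-- `x_c`-mass of arcs. [verbatim copy] -/
def arcMass (H : SimpleGraph (Site 2)) (Λ : Set (Site 2)) (c c' : Site 2) : ℝ≥0∞ :=
  ∑' p : Arc H Λ c c', ENNReal.ofReal (criticalFugacity ^ p.1.length)

/-- `x_c`-mass of arcs making `k` weak vertex traversals of `D(z₀; n, R)`. [verbatim copy] -/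
def travMass (H : SimpleGraph (Site 2)) (Λ : Set (Site 2)) (c c' : Site 2) (k : ℕ) (z₀ : ℂ)
    (n R : ℝ) : ℝ≥0∞ :=
  ∑' p : {p : Arc H Λ c c' // HasVertexTraversals (p.1.support.map Site.toComplex) k z₀ n R},
    ENNReal.ofReal (criticalFugacity ^ p.1.1.length)

/-- **Kernel tail**: the fugacity-`x` mass of full-lattice SAWs `u → v` of length `≥ n₀`,
`K_x^{≥ n₀}(u,v) = Σ_{γ : u → v SAW of ℤ², |γ| ≥ n₀} x^{|γ|} ∈ [0,∞]`. At `x = x_c`, `v = u + e₀` this is the tail of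
the critical bubble / of the rooted polygon series `Σ_{N ≥ n₀+1} (N/2) q_N x_c^{N-1}`. -/
def kernelTail (x : ℝ) (u v : Site 2) (n₀ : ℕ) : ℝ≥0∞ :=
  ∑' p : {p : LatticeSAW u v // n₀ ≤ p.1.length}, ENNReal.ofReal (x ^ p.1.1.length)

/-- **The pinched-door sector of the bulk atom** (X2c₁ᵇ with the extra hypothesis that the two inner
door vertices are lattice neighbours, and with traversal threshold `k = 1`): for every `θ > 0` there is
`N₀` such that for every finite exterior confined to `B̄(z₀, C·N)`, virgin at `(z₀, N)`, `N ≥ N₀`, and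
doors `(u,c)`, `(u',c')` with `c ∼ c'`, the `x_c`-mass of arcs `c → c'` in `Λ` whose vertex sequence makes ONE
weak traversal of `D(z₀; 2N/5, 3N/5)` is `≤ θ ·` (mass of all arcs). (Here `k = 1 ≤ k(C,θ)` for any
registered threshold, so this is a sub-statement of X2c₁ᵇ by `HasVertexTraversals` monotonicity in `k`.) -/
def PinchedDoorArcTight : Prop :=
  ∀ C θ : ℝ, 0 < θ → ∃ N₀ : ℝ, 0 < N₀ ∧
    ∀ (H : SimpleGraph (Site 2)) (Λ : Set (Site 2)) (z₀ : ℂ) (N : ℝ) (u c u' c' : Site 2),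
      Λ.Finite → (∀ v ∈ Λ, dist (Site.toComplex v) z₀ ≤ C * N) → N₀ ≤ N →
      IsVirgin H Λ z₀ N → IsDoor H Λ z₀ N u c → IsDoor H Λ z₀ N u' c' →
      (zdGraph 2).Adj c c' →
        travMass H Λ c c' 1 z₀ (2 * N / 5) (3 * N / 5) ≤ ENNReal.ofReal θ * arcMass H Λ c c'

/-- **L1 (numerator, exterior-proof).** An arc from the rim door `c` (`N - 1 < |c - z₀| ≤ N`) that visits
`B̄(z₀, 2N/5)` and returns to `c' ∼ c` has at least `2 (3N/5 - 1) ≥ N` lattice steps (`N ≥ 10`); `H ≤ ℤ²`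
makes every `H`-arc a lattice SAW of the same length, injectively. Hence the one-traversal mass is bounded by
the kernel tail, for EVERY exterior. [folklore; size M] -/
theorem travMass_one_le_kernelTail
    (H : SimpleGraph (Site 2)) (Λ : Set (Site 2)) (z₀ : ℂ) (N : ℝ) (u c u' c' : Site 2)
    (hN : 10 ≤ N) (hV : IsVirgin H Λ z₀ N) (hD : IsDoor H Λ z₀ N u c) (hD' : IsDoor H Λ z₀ N u' c')
    (hadj : (zdGraph 2).Adj c c') :
    travMass H Λ c c' 1 z₀ (2 * N / 5) (3 * N / 5) ≤ kernelTail criticalFugacity c c' ⌈N⌉₊ := by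
  sorry

/-- **L2 (free denominator).** For adjacent inner door vertices the one-edge walk `c → c'` is an arc
(both in `Λ`, both in the closed `N`-disc, hence an `H`-edge by virginity), of weight `x_c`. [folklore; size S] -/
theorem ofReal_criticalFugacity_le_arcMass
    (H : SimpleGraph (Site 2)) (Λ : Set (Site 2)) (z₀ : ℂ) (N : ℝ) (u c u' c' : Site 2)
    (hV : IsVirgin H Λ z₀ N) (hD : IsDoor H Λ z₀ N u c) (hD' : IsDoor H Λ z₀ N u' c')
    (hadj : (zdGraph 2).Adj c c') :
    ENNReal.ofReal criticalFugacity ≤ arcMass H Λ c c' := by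
  sorry

/-- **L3 (the one-point input).** If the critical bubble is finite then the kernel tail at adjacent points
tends to `0` (tails of a convergent `ℝ≥0∞`-series; translation/dihedral invariance of the kernel,
`latticeKernel_shift`, `bubble_eq_bubble_e₀`). [folklore; size M] -/
theorem kernelTail_tendsto_zero_of_criticalBubbleBound (h : CriticalBubbleBound) (u v : Site 2)
    (huv : (zdGraph 2).Adj u v) :
    Tendsto (fun n₀ : ℕ => kernelTail criticalFugacity u v n₀) atTop (𝓝 0) := by
  sorry

/-- **L4 (the sector closes by name from stmt-7117).** `CriticalBubbleBound → PinchedDoorArcTight`: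
given `θ`, L3 (uniform over the four directions) gives `n₀` with `K^{≥ n₀}_{x_c}(c,c') ≤ θ x_c`; take
`N₀ = max 10 n₀`, then L1 and L2. -/
theorem pinchedDoorArcTight_of_criticalBubbleBound (h : CriticalBubbleBound) : PinchedDoorArcTight := by
  sorry

/-- Sanity: the registered atom implies the pinched-door sector (specialise, `k = 1 ≤ k(C,θ)` absorbed by
monotonicity of `HasVertexTraversals` in the threshold — stated here as the `k`-monotone form one proves). -/
theorem travMass_anti_k (H : SimpleGraph (Site 2)) (Λ : Set (Site 2)) (c c' : Site 2) (z₀ : ℂ) (n R : ℝ)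
    {k k' : ℕ} (hk : k ≤ k') : travMass H Λ c c' k' z₀ n R ≤ travMass H Λ c c' k z₀ n R := by
  sorry

end Summit.CriticalPhenomena.SAWScalingLimit.Cruxes.BulkShellTight.DoorPinchBubble

end
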